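import Mathlib
import HarnessLib
import Summits.HubbardSuperconductivity.HubbardSuperconductivity.Theorems.KLProgrammeKLRegimeThinPairDiffWt
import Summits.HubbardSuperconductivity.HubbardSuperconductivity.Theorems.KLProgrammeKLRegimeIncrScaleRates

/-!
# K3 VL child `KLRegimeVolumeLimitV17F2` (stmt-HubbardSuperconductivity-20440), located item #23 «W2-HALF-VL», brick «W2H-OVL» part 12 (D-LEVEL, scale form):
# the weighted `ℓ¹` bound of the thin-pair FRAME DIFFERENCE `D = Gs₁ − Gs₂` from the two increment pairs' RELATIVE SCALE-FORM data, rates solved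

Cell `gate-hubbard-kl`, seat p3 (g14), lead of #23.  The two increment pairs of the split (`klAnisoPairDiff_eq_incr_sub_incr`) come with amplitudes `B₁, B₂` and
relative scale-form difference data (`…ThinMultiplierIncrementPairScale{Iso,Tan,Time}`: axes / normal step third order `≤ B_t‖toLp w‖³R₃⁽ᵗ⁾(x)`, tangent step
third `≤ B_t‖toLp w_v‖³Rv₃⁽ᵗ⁾(x)` and second `≤ B_t‖toLp w_v‖²W⁽ᵗ⁾(x)`, time third `≤ B_tθ⁽ᵗ⁾`, sup `≤ B_t`).  Summing the two terms coefficientwise puts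
`D` in the class of `charSumWt_le_incrScale` (`…IncrScaleRates`) with amplitude `A = B₁ + B₂`; the support of `D` is k3c4-p2's `card_support_thinPairDiff_le`:

* **`charSumWt_thinPairDiff_le_incrScale`** — at the rates `s₁ = ρ/x`, `s₂ = s₃′ = ρ/(x|v|)`, `s₃ = ρ₃/(x|v|)`:
  `Σ_z (1 + s₀|z̃₁| + (ρ/x)(|z̃₂⁰|+|z̃₂¹|))·‖Σ_q χχ • D(q)‖ ≤ x·√(524288(1/s₀+1)[(1+4√2)²(2√2/ρ+2)(2√2/ρ₃+2) + (1/ρ+1)²])·√(24·2M·L²·N^Δ)·(B₁+B₂)`,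
  `N^Δ = 2 ×` p4's pair count, under the two time conditions and the eleven monomial depth conditions on the SUMMED coefficients.

Pure packaging; no definitions, no sorry.  Nothing asserts any stub, K3, VL or superconductivity.
[cite: BenfattoGiulianiMastropietro2006, Lemma 2.2 (2.52)–(2.55), §2.6 (2.81), §2.7 (2.71a), §3 (3.3)–(3.8)]
-/

noncomputable section

namespace Summit.HubbardSuperconductivity.HubbardSuperconductivity.Theorems.TorusFourierL2

set_option linter.dupNamespace false -- summit = problem name (single-conjunct summit), D-0017

open Set Finset Literature.MathematicalPhysics.QuantumLattice Literature.MathematicalPhysics.QuantumLattice.BandSectorCounting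
open Literature.MathematicalPhysics.QuantumLattice.FermiRG Literature.Probability.LatticeModels Literature.Analysis.SpecialFunctions
open Summit.HubbardSuperconductivity.HubbardSuperconductivity.Theorems.DispersionFlow
open Summit.HubbardSuperconductivity.HubbardSuperconductivity.Theorems.KLRegimeSplit
open Summit.HubbardSuperconductivity.HubbardSuperconductivity.Theorems.KLProgrammeLegKernels
open Summit.HubbardSuperconductivity.HubbardSuperconductivity.Theorems.PerturbedFermiCurve
open scoped Real

section ThinPairDiffIncrScale

variable {L M : ℕ} [NeZero L] [NeZero M] {a b : ℝ} (B : BandBounds a b) {K K' : TrigPolyC4v} {A : ℝ}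
  (hA : ∀ p : Momentum, ∀ j ≤ 2, ‖iteratedFDeriv ℝ j (frameShift K) p‖ ≤ A)
  (hA' : ∀ p : Momentum, ∀ j ≤ 2, ‖iteratedFDeriv ℝ j (frameShift K') p‖ ≤ A) (hADt : 2 * A < B.Dtmin)
  {μ e₀ z β : ℝ} (he : 0 < e₀) (hz : 0 < z) (hz1 : z ≤ 1) (hgap : e₀ + A + z ^ 2 < -μ) (h3 : e₀ + A - μ ≤ 3)
  (hlo : a ≤ μ - A - e₀) (hhi : μ + A + e₀ ≤ b) (hβ : 0 < β) (hρA : 4 * A < 2 * B.rhomin)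
  {n₁ n₂ : ℕ} (hn : n₂ ≤ n₁) (ω₁ : Fin (sectorCount n₁)) (ω₂ : Fin (sectorCount n₂))
  {d : ℝ} (hd : 0 ≤ d) (hd1 : ∀ u, |deriv (bgmCutoffSq e₀) u| ≤ d) (hd2 : ∀ u, |iteratedDeriv 2 (bgmCutoffSq e₀) u| ≤ d)
  {Z : (Fin 2 → ℝ) → ℝ}
  (hZ : ∀ p, Z p = gnCutoff ((π + z) ^ 2 / π ^ 2) ((π + z) ^ 2) (p 0 ^ 2) * gnCutoff ((π + z) ^ 2 / π ^ 2) ((π + z) ^ 2) (p 1 ^ 2) *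
    ((radialCutoffC (1 / 2) (momToComplex p) * sectorWeightCirc n₁ ((ω₁ : ℕ) : ℤ) (polarAngle p)) *
      (radialCutoffC (1 / 2) (momToComplex p) * sectorWeightCirc n₂ ((ω₂ : ℕ) : ℤ) (polarAngle p))))
  {Ds : TorusSite 1 (2 * M) × TorusSite 2 L → ℂ}
  (hDs : ∀ q, Ds q = klAnisoFamily L M β μ K' e₀ n₁ ω₁ (⟨(q.1 0).val, ZMod.val_lt (q.1 0)⟩, q.2) *
      klAnisoFamily L M β μ K' e₀ n₂ ω₂ (⟨(q.1 0).val, ZMod.val_lt (q.1 0)⟩, q.2) -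
    klAnisoFamily L M β μ K e₀ n₁ ω₁ (⟨(q.1 0).val, ZMod.val_lt (q.1 0)⟩, q.2) *
      klAnisoFamily L M β μ K e₀ n₂ ω₂ (⟨(q.1 0).val, ZMod.val_lt (q.1 0)⟩, q.2))
  (Gs₁ Gs₂ : TorusSite 1 (2 * M) × TorusSite 2 L → ℂ) (hsplit : ∀ q, Ds q = Gs₁ q - Gs₂ q)

include B hA hA' hADt he hz hz1 hgap h3 hlo hhi hβ hρA hn hd hd1 hd2 hZ hDs hsplit in
set_option maxHeartbeats 1600000 in
/-- **Weighted `ℓ¹` of the thin-pair frame difference from the two increment pairs' relative scale-form data, rates solved** (see the module docstring).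
[cite: BenfattoGiulianiMastropietro2006, Lemma 2.2 (2.52)–(2.55), §2.6 (2.81), §2.7 (2.71a), §3 (3.3)–(3.8)] -/
theorem charSumWt_thinPairDiff_le_incrScale
    (v : Fin 2 → ℤ) (hv : v ≠ 0) {s₀ ρ ρ₃ x : ℝ} (hs₀ : 0 < s₀) (hρ : 0 < ρ) (hρ₃ : 0 < ρ₃) (hx : 1 ≤ x)
    {B₁ B₂ : ℝ} (hB₁ : 0 ≤ B₁) (hB₂ : 0 ≤ B₂) (hS₁ : ∀ q, ‖Gs₁ q‖ ≤ B₁) (hS₂ : ∀ q, ‖Gs₂ q‖ ≤ B₂)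
    -- time, order three
    {θ₁ θ₂ : ℝ}
    (hT₁ : ∀ q, ‖((fwdDiff ((fun _ : Fin 1 => (1 : ZMod (2 * M))), (0 : TorusSite 2 L)))^[3] Gs₁) q‖ ≤ B₁ * θ₁)
    (hT₂ : ∀ q, ‖((fwdDiff ((fun _ : Fin 1 => (1 : ZMod (2 * M))), (0 : TorusSite 2 L)))^[3] Gs₂) q‖ ≤ B₂ * θ₂)
    (hθ₁ : θ₁ ≤ (4 / (s₀ * (2 * M : ℕ))) ^ 3) (hθ₂ : θ₂ ≤ (4 / (s₀ * (2 * M : ℕ))) ^ 3)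
    -- iso families (axes and the normal step): third order
    {r₀ r₁ r₂ r₃ r₀' r₁' r₂' r₃' : ℝ} (hr : 0 ≤ r₀ ∧ 0 ≤ r₁ ∧ 0 ≤ r₂ ∧ 0 ≤ r₃) (hr' : 0 ≤ r₀' ∧ 0 ≤ r₁' ∧ 0 ≤ r₂' ∧ 0 ≤ r₃')
    (hX₁ : ∀ (u : Fin 2 → ℤ), (u = Pi.single 0 1 ∨ u = Pi.single 1 1 ∨ u = ![-v 1, v 0]) → ∀ q,
      ‖((fwdDiff ((0 : TorusSite 1 (2 * M)), (fun j => ((u j : ℤ) : ZMod L))))^[3] Gs₁) q‖ ≤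
        B₁ * (‖(WithLp.toLp 2 (fun j => 2 * π / L * (u j : ℝ)) : EuclideanSpace ℝ (Fin 2))‖ ^ 3 * (r₀ + r₁ * x + r₂ * x ^ 2 + r₃ * x ^ 3)))
    (hX₂ : ∀ (u : Fin 2 → ℤ), (u = Pi.single 0 1 ∨ u = Pi.single 1 1 ∨ u = ![-v 1, v 0]) → ∀ q,
      ‖((fwdDiff ((0 : TorusSite 1 (2 * M)), (fun j => ((u j : ℤ) : ZMod L))))^[3] Gs₂) q‖ ≤
        B₂ * (‖(WithLp.toLp 2 (fun j => 2 * π / L * (u j : ℝ)) : EuclideanSpace ℝ (Fin 2))‖ ^ 3 * (r₀' + r₁' * x + r₂' * x ^ 2 + r₃' * x ^ 3)))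
    -- tangent families: third and second order along `v`
    {rv₀ rv₁ rv₂ rv₃ rv₀' rv₁' rv₂' rv₃' w₀ w₁ w₂ w₀' w₁' w₂' : ℝ}
    (hrv : 0 ≤ rv₀ ∧ 0 ≤ rv₁ ∧ 0 ≤ rv₂ ∧ 0 ≤ rv₃) (hrv' : 0 ≤ rv₀' ∧ 0 ≤ rv₁' ∧ 0 ≤ rv₂' ∧ 0 ≤ rv₃')
    (hw : 0 ≤ w₀ ∧ 0 ≤ w₁ ∧ 0 ≤ w₂) (hw' : 0 ≤ w₀' ∧ 0 ≤ w₁' ∧ 0 ≤ w₂')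
    (hV₁ : ∀ q, ‖((fwdDiff ((0 : TorusSite 1 (2 * M)), (fun j => ((v j : ℤ) : ZMod L))))^[3] Gs₁) q‖ ≤
      B₁ * (‖(WithLp.toLp 2 (fun j => 2 * π / L * (v j : ℝ)) : EuclideanSpace ℝ (Fin 2))‖ ^ 3 * (rv₀ + rv₁ * x + rv₂ * x ^ 2 + rv₃ * x ^ 3)))
    (hV₂ : ∀ q, ‖((fwdDiff ((0 : TorusSite 1 (2 * M)), (fun j => ((v j : ℤ) : ZMod L))))^[3] Gs₂) q‖ ≤
      B₂ * (‖(WithLp.toLp 2 (fun j => 2 * π / L * (v j : ℝ)) : EuclideanSpace ℝ (Fin 2))‖ ^ 3 * (rv₀' + rv₁' * x + rv₂' * x ^ 2 + rv₃' * x ^ 3)))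
    (hW₁ : ∀ q, ‖((fwdDiff ((0 : TorusSite 1 (2 * M)), (fun j => ((v j : ℤ) : ZMod L))))^[2] Gs₁) q‖ ≤
      B₁ * (‖(WithLp.toLp 2 (fun j => 2 * π / L * (v j : ℝ)) : EuclideanSpace ℝ (Fin 2))‖ ^ 2 * (w₀ + w₁ * x + w₂ * x ^ 2)))
    (hW₂ : ∀ q, ‖((fwdDiff ((0 : TorusSite 1 (2 * M)), (fun j => ((v j : ℤ) : ZMod L))))^[2] Gs₂) q‖ ≤
      B₂ * (‖(WithLp.toLp 2 (fun j => 2 * π / L * (v j : ℝ)) : EuclideanSpace ℝ (Fin 2))‖ ^ 2 * (w₀' + w₁' * x + w₂' * x ^ 2)))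
    -- the eleven monomial depth conditions on the summed coefficients
    (t₀ : π ^ 3 * ρ ^ 3 * (r₀ + r₀') ≤ 2 * x ^ 3) (t₁ : π ^ 3 * ρ ^ 3 * (r₁ + r₁') ≤ 2 * x ^ 2) (t₂ : π ^ 3 * ρ ^ 3 * (r₂ + r₂') ≤ 2 * x)
    (t₃ : π ^ 3 * ρ ^ 3 * (r₃ + r₃') ≤ 2)
    (tv₀ : π ^ 3 * ρ ^ 3 * (rv₀ + rv₀') ≤ 2 * x ^ 3) (tv₁ : π ^ 3 * ρ ^ 3 * (rv₁ + rv₁') ≤ 2 * x ^ 2) (tv₂ : π ^ 3 * ρ ^ 3 * (rv₂ + rv₂') ≤ 2 * x)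
    (tv₃ : π ^ 3 * ρ ^ 3 * (rv₃ + rv₃') ≤ 2)
    (tw₀ : 3 * π ^ 2 * ρ₃ ^ 2 * (w₀ + w₀') ≤ 4 * x ^ 2) (tw₁ : 3 * π ^ 2 * ρ₃ ^ 2 * (w₁ + w₁') ≤ 4 * x) (tw₂ : 3 * π ^ 2 * ρ₃ ^ 2 * (w₂ + w₂') ≤ 4) :
    ∑ zz : TorusSite 1 (2 * M) × TorusSite 2 L,
        (1 + s₀ * |(((zz.1 0).valMinAbs : ℤ) : ℝ)| + ρ / x * |(((zz.2 0).valMinAbs : ℤ) : ℝ)| + ρ / x * |(((zz.2 1).valMinAbs : ℤ) : ℝ)|) *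
          ‖∑ q : TorusSite 1 (2 * M) × TorusSite 2 L, (torusChar q.1 zz.1 * torusChar q.2 zz.2) • Ds q‖ ≤
      x * Real.sqrt (524288 * (1 / s₀ + 1) * ((1 + 4 * Real.sqrt 2) ^ 2 * ((2 * Real.sqrt 2 / ρ + 2) * (2 * Real.sqrt 2 / ρ₃ + 2)) + (1 / ρ + 1) ^ 2)) *
        Real.sqrt (24 * (2 * M : ℕ) * (L : ℝ) ^ 2 *
          (2 * ((klScale e₀ n₁ * β / π + 1) *
            ((Real.sqrt 2 * L * ((klScale e₀ n₁ + (4 + 4 * A) *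
                ((klScale e₀ n₁ + B.smax * B.Dtmin * (3 * sectorWidth n₂ / 4)) / (B.Dtmin - 2 * A)) ^ 2) / (2 * B.rhomin - 4 * A)) / π + 2) *
              (Real.sqrt 2 * L * (2 * ((klScale e₀ n₁ + B.smax * B.Dtmin * (3 * sectorWidth n₂ / 4)) / (B.Dtmin - 2 * A))) / π + 2))))) * (B₁ + B₂) := by
  classical
  have hL : (0 : ℝ) < L := Nat.cast_pos.2 (Nat.pos_of_ne_zero (NeZero.ne L))
  have hx0 : 0 < x := lt_of_lt_of_le one_pos hx
  have hπ := Real.pi_pos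
  obtain ⟨h0, h1, h2, h3'⟩ := hr
  obtain ⟨h0', h1', h2', h3''⟩ := hr'
  obtain ⟨g0, g1, g2, g3⟩ := hrv
  obtain ⟨g0', g1', g2', g3''⟩ := hrv'
  obtain ⟨e0, e1, e2⟩ := hw
  obtain ⟨e0', e1', e2'⟩ := hw'
  -- `D = G₁ − G₂` and the triangle inequality on iterated differences
  have hDfun : Ds = fun q => Gs₁ q - Gs₂ q := funext hsplit
  have hdiff : ∀ (h : TorusSite 1 (2 * M) × TorusSite 2 L) (n : ℕ) (q : TorusSite 1 (2 * M) × TorusSite 2 L) {b₁ b₂ : ℝ},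
      ‖((fwdDiff h)^[n] Gs₁) q‖ ≤ b₁ → ‖((fwdDiff h)^[n] Gs₂) q‖ ≤ b₂ → ‖((fwdDiff h)^[n] Ds) q‖ ≤ b₁ + b₂ := by
    intro h n q b₁ b₂ h₁ h₂
    rw [hDfun, fwdDiff_iter_sub_apply]
    exact (norm_sub_le _ _).trans (add_le_add h₁ h₂)
  -- combining two relative bounds: `B₁ηᵏR + B₂ηᵏR′ ≤ (B₁+B₂)ηᵏ(R+R′)`
  have comb : ∀ {E R R' : ℝ}, 0 ≤ E → 0 ≤ R → 0 ≤ R' → B₁ * (E * R) + B₂ * (E * R') ≤ (B₁ + B₂) * (E * (R + R')) := by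
    intro E R R' hE hR hR'
    have a1 : B₁ * (E * R) ≤ B₁ * (E * (R + R')) := mul_le_mul_of_nonneg_left (mul_le_mul_of_nonneg_left (le_add_of_nonneg_right hR') hE) hB₁
    have a2 : B₂ * (E * R') ≤ B₂ * (E * (R + R')) := mul_le_mul_of_nonneg_left (mul_le_mul_of_nonneg_left (le_add_of_nonneg_left hR) hE) hB₂
    linarith only [a1, a2]
  have hR₃ : 0 ≤ r₀ + r₁ * x + r₂ * x ^ 2 + r₃ * x ^ 3 := by positivity
  have hR₃' : 0 ≤ r₀' + r₁' * x + r₂' * x ^ 2 + r₃' * x ^ 3 := by positivity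
  have hRv : 0 ≤ rv₀ + rv₁ * x + rv₂ * x ^ 2 + rv₃ * x ^ 3 := by positivity
  have hRv' : 0 ≤ rv₀' + rv₁' * x + rv₂' * x ^ 2 + rv₃' * x ^ 3 := by positivity
  have hWp : 0 ≤ w₀ + w₁ * x + w₂ * x ^ 2 := by positivity
  have hWp' : 0 ≤ w₀' + w₁' * x + w₂' * x ^ 2 := by positivity
  -- step norms
  have hηe : ∀ i : Fin 2, ‖(WithLp.toLp 2 (fun j => 2 * π / L * ((Pi.single i (1 : ℤ) : Fin 2 → ℤ) j : ℝ)) : EuclideanSpace ℝ (Fin 2))‖ = 2 * π / L * 1 := by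
    intro i
    rw [norm_toLp_latticeStep]
    fin_cases i <;> simp
  have hηn : ‖(WithLp.toLp 2 (fun j => 2 * π / L * ((![-v 1, v 0] : Fin 2 → ℤ) j : ℝ)) : EuclideanSpace ℝ (Fin 2))‖ =
      2 * π / L * Real.sqrt ((v 0 : ℝ) ^ 2 + (v 1 : ℝ) ^ 2) := by
    rw [norm_toLp_latticeStep]
    congr 1
    simp only [Matrix.cons_val_zero, Matrix.cons_val_one, Int.cast_neg]
    ring_nf
  have hηv : ‖(WithLp.toLp 2 (fun j => 2 * π / L * (v j : ℝ)) : EuclideanSpace ℝ (Fin 2))‖ = 2 * π / L * Real.sqrt ((v 0 : ℝ) ^ 2 + (v 1 : ℝ) ^ 2) :=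
    norm_toLp_latticeStep L v
  -- the inputs of `charSumWt_le_incrScale` for `D` with `A = B₁ + B₂`
  have hA0 : 0 ≤ B₁ + B₂ := add_nonneg hB₁ hB₂
  have hsup : ∀ q, ‖Ds q‖ ≤ B₁ + B₂ := fun q => by
    rw [hsplit]; exact (norm_sub_le _ _).trans (add_le_add (hS₁ q) (hS₂ q))
  have m0 : ∀ q, ‖((fwdDiff ((fun _ : Fin 1 => (1 : ZMod (2 * M))), (0 : TorusSite 2 L)))^[3] Ds) q‖ ≤ (B₁ + B₂) * (4 / (s₀ * (2 * M : ℕ))) ^ 3 := by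
    intro q
    refine (hdiff _ 3 q (hT₁ q) (hT₂ q)).trans ?_
    have a1 := mul_le_mul_of_nonneg_left hθ₁ hB₁
    have a2 := mul_le_mul_of_nonneg_left hθ₂ hB₂
    linarith only [a1, a2]
  have m1 : ∀ q (i : Fin 2), ‖((fwdDiff ((0 : TorusSite 1 (2 * M)), (Pi.single i (1 : ZMod L) : TorusSite 2 L)))^[3] Ds) q‖ ≤
      (B₁ + B₂) * ((2 * π / L * 1) ^ 3 * ((r₀ + r₀') + (r₁ + r₁') * x + (r₂ + r₂') * x ^ 2 + (r₃ + r₃') * x ^ 3)) := by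
    intro q i
    have hsingle : (Pi.single i (1 : ZMod L) : TorusSite 2 L) = fun j => (((Pi.single i (1 : ℤ) : Fin 2 → ℤ) j : ℤ) : ZMod L) := by
      funext j; by_cases hj : j = i
      · subst hj; simp
      · simp [hj]
    have hor : (Pi.single i (1 : ℤ) : Fin 2 → ℤ) = Pi.single 0 1 ∨ (Pi.single i (1 : ℤ) : Fin 2 → ℤ) = Pi.single 1 1 ∨
        (Pi.single i (1 : ℤ) : Fin 2 → ℤ) = ![-v 1, v 0] := by
      fin_cases i
      · exact Or.inl rfl
      · exact Or.inr (Or.inl rfl)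
    have b₁ := hX₁ _ hor q
    have b₂ := hX₂ _ hor q
    rw [hηe i] at b₁ b₂
    rw [hsingle]
    refine (hdiff _ 3 q b₁ b₂).trans ?_
    refine (comb (by positivity) hR₃ hR₃').trans (le_of_eq ?_)
    ring
  have m2 : ∀ q, ‖((fwdDiff ((0 : TorusSite 1 (2 * M)), (fun j => ((![-v 1, v 0] j : ℤ) : ZMod L))))^[3] Ds) q‖ ≤
      (B₁ + B₂) * ((2 * π / L * Real.sqrt ((v 0 : ℝ) ^ 2 + (v 1 : ℝ) ^ 2)) ^ 3 *
        ((r₀ + r₀') + (r₁ + r₁') * x + (r₂ + r₂') * x ^ 2 + (r₃ + r₃') * x ^ 3)) := by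
    intro q
    have b₁ := hX₁ _ (Or.inr (Or.inr rfl)) q
    have b₂ := hX₂ _ (Or.inr (Or.inr rfl)) q
    rw [hηn] at b₁ b₂
    refine (hdiff _ 3 q b₁ b₂).trans ?_
    refine (comb (by positivity) hR₃ hR₃').trans (le_of_eq ?_)
    ring
  have m3' : ∀ q, ‖((fwdDiff ((0 : TorusSite 1 (2 * M)), (fun j => ((v j : ℤ) : ZMod L))))^[3] Ds) q‖ ≤
      (B₁ + B₂) * ((2 * π / L * Real.sqrt ((v 0 : ℝ) ^ 2 + (v 1 : ℝ) ^ 2)) ^ 3 *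
        ((rv₀ + rv₀') + (rv₁ + rv₁') * x + (rv₂ + rv₂') * x ^ 2 + (rv₃ + rv₃') * x ^ 3)) := by
    intro q
    have b₁ := hV₁ q
    have b₂ := hV₂ q
    rw [hηv] at b₁ b₂
    refine (hdiff _ 3 q b₁ b₂).trans ?_
    refine (comb (by positivity) hRv hRv').trans (le_of_eq ?_)
    ring
  have m3 : ∀ q, ‖((fwdDiff ((0 : TorusSite 1 (2 * M)), (fun j => ((v j : ℤ) : ZMod L))))^[2] Ds) q‖ ≤
      (B₁ + B₂) * ((2 * π / L * Real.sqrt ((v 0 : ℝ) ^ 2 + (v 1 : ℝ) ^ 2)) ^ 2 * ((w₀ + w₀') + (w₁ + w₁') * x + (w₂ + w₂') * x ^ 2)) := by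
    intro q
    have b₁ := hW₁ q
    have b₂ := hW₂ q
    rw [hηv] at b₁ b₂
    refine (hdiff _ 2 q b₁ b₂).trans ?_
    refine (comb (by positivity) hWp hWp').trans (le_of_eq ?_)
    ring
  -- the support count of the difference (k3c4-p2) and the generic rate lemma
  have hNs := card_support_thinPairDiff_le B hA hA' hADt he hz hz1 hgap h3 hlo hhi hβ hρA hn ω₁ ω₂ hd hd1 hd2 hZ hDs
  have main := charSumWt_le_incrScale Ds v hv hs₀ hρ hρ₃ hx hA0 (le_refl _) hsup (θ₃ := (4 / (s₀ * (2 * M : ℕ))) ^ 3) m0 le_rfl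
    m1 m2 m3' m3 t₀ t₁ t₂ t₃ tv₀ tv₁ tv₂ tv₃ tw₀ tw₁ tw₂
  refine main.trans ?_
  gcongr

end ThinPairDiffIncrScale

end Summit.HubbardSuperconductivity.HubbardSuperconductivity.Theorems.TorusFourierL2

end
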